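import Literature.AlgebraicGeometry.AbelianVarieties.HomogeneousSymmetricDivisorTwoTorsion
import Literature.AlgebraicGeometry.AbelianSchemes.IsLambdaOfAtWitnessCongruence
import Literature.AlgebraicGeometry.Motives.AbelianVarietyPicZeroOfAmple
import Literature.AlgebraicGeometry.Motives.AlgPointsMapSurjectiveAlgClosed
import Literature.AlgebraicGeometry.Motives.AbelianVarietyWeilPairingPullback
import Literature.AlgebraicGeometry.Motives.AbelianVarietyKummerBound
import HarnessLib

/-!
# A polarisation has a SYMMETRIC ample witness: `λ̄ = Λ(𝒪(Θ))` with `(−1)^*Θ ∼ Θ` (Mumford §8; MFK Def. 6.2–6.3)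

Layer `Literature/AlgebraicGeometry/AbelianSchemes`, namespace `Literature.AlgebraicGeometry.AbelianSchemes.AbelianSchemeOver`.
THEOREMS ONLY (no definition, no named fact, no instance, no `sorry`).

Setting: an abelian scheme `A/S` with a dual pair `D = (Â, 𝒫)`, an `S`-morphism `λ : A → Â`, a geometric point
`s : Spec Ω → S` (`Ω` algebraically closed), the fibre abelian variety `X := A_s`, its inversion
`(−1) = ((𝟙 X)⁻¹).left` and the Weil divisors `D_Q(Θ) = t_Q^*Θ − Θ` (★ `weilDiv`).  [MumfordAV1970] §8 (iii):
`(−1)^*` acts by `−1` on translation-invariant classes (★ `cechClass_classPullback_inv_eq_inv`), and §6 Cor. 4 (theorem of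
the square, ★ `weilDiv_mul_linEquiv`).  Consequences, all in the currency of ★ `IsLambdaOfAt` ([MumfordFogartyKirwan1994]
Def. 6.2–6.3, «`λ̄ = Λ(𝒪(Θ))` on points»):

* §1 `weilDiv_translationInvariant` (`t_Q^*D_R(Θ) ∼ D_R(Θ)`), `translation_left_comp_inv` (`t_P ≫ (−1) = (−1) ≫ t_{P⁻¹}`),
  `IsLambdaOfAt.of_forall_weilDiv_linEquiv` (a divisor with the same `D_P`-classes is again a witness);
* §2 **`IsLambdaOfAt.classPullback_inv`** — «`(−1)^*` of a witness is a witness»: `Λ(𝒪((−1)^*Θ)) = Λ(𝒪(Θ))`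
  (`D_P((−1)^*Θ) = (−1)^*D_{P⁻¹}(Θ) ∼ −D_{P⁻¹}(Θ) ∼ D_P(Θ)`); **`IsLambdaOfAt.pullback_translation`** — «a translate of
  a witness is a witness» (`D_P(t_y^*Θ) = D_{yP}(Θ) − D_y(Θ) ∼ D_P(Θ)`);
* §3 **`IsLambdaOfAt.exists_symmetric_translate`** — if the translation-invariant class `Z := (−1)^*Θ − Θ` is a `D_a(Θ)`
  (hypothesis `hZ`; Mumford §8 Thm. 1 at `s`) and `2` is invertible in `Ω`, then for `y² = a` (★ `exists_pow_eq_of_isAlgClosed`)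
  the translate `Θ′ := t_y^*Θ` is an AMPLE (★ `IsAmple.pullback`) SYMMETRIC (`(−1)^*Θ′ ∼ Θ′`) witness of the same `λ̄`;
* §4 **`Polarization.exists_isAmple_isLambdaOfAt_symmetric_of_complexPoint`** — UNCONDITIONALLY at every COMPLEX point of any
  base: `hZ` holds by ★ witness congruence `IsLambdaOfAt.linEquiv_pullback_translation_sub` (`Z` is translation-invariant, §2)
  and ★ Mumford §8 Thm. 1 over `ℂ` `exists_linEquiv_weilDiv_of_forall_translate_linEquiv`;
  `Polarization.exists_isAmple_isLambdaOfAt_symmetric_of_forall_exists_linEquiv_weilDiv` — the same at any algebraically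
  closed point from the per-point Mumford-§8 hypothesis.

Purpose (cell `hodgecm-mathlib`, D-0151; Hecke-link socket (B), (X-amp) plan, hand (h1) «a symmetric translate of the ample
witness `Θ′` exists»): the symmetric `Θ′` feeding (X-amp-2) `Θ₀ := φ_d^*Θ′` and the (X-amp-3) assembler ★
`exists_isAmple_isLambdaOfAt_of_symmetric_witnesses` (its `hΘ₀sym` clause is this file's spelling).  Count-neutral; HC_CM is proved
only modulo the 7 printed citations until rung 0 closes.

## References
* [MumfordAV1970] D. Mumford, *Abelian Varieties* (1970), §6 Cor. 4 (p. 59) (theorem of the square), §8 (ii)–(iv)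
  (pp. 74–75) and §8 Thm. 1 (p. 77).
* [MumfordFogartyKirwan1994] D. Mumford, J. Fogarty, F. Kirwan, *Geometric Invariant Theory*, 3rd ed. (1994), Ch. 6 §2
  Def. 6.2–6.3 (p. 120).
-/

set_option autoImplicit false

noncomputable section

universe u

open CategoryTheory CategoryTheory.Limits AlgebraicGeometry MonoidalCategory
open scoped MonObj

namespace Literature.AlgebraicGeometry.AbelianSchemes

open Literature.AlgebraicGeometry.Motives Literature.AlgebraicGeometry.AbelianVarieties Literature.AlgebraicGeometry.Modules

namespace AbelianSchemeOver

/-! ## §1 Bookkeeping on the fibre: translation-invariance of `D_R(Θ)`, `t_P ≫ (−1) = (−1) ≫ t_{P⁻¹}` -/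

section Fibre

variable {K : Type u} [Field K] (X : AbelianVariety K)

/-- **`D_R(Θ) = t_R^*Θ − Θ` is translation-invariant**: `t_Q^*D_R(Θ) ∼ D_R(Θ)` — the theorem of the square
(`t_Q^*D_R + D_Q ∼ D_{RQ} ∼ D_R + D_Q`, ★ `pullback_translation_weilDiv_add_linEquiv`, ★ `weilDiv_mul_linEquiv`).
[cite: MumfordAV1970, §6 Cor. 4 (p. 59) and §8 (pp. 74–75)] -/
theorem weilDiv_translationInvariant (Θ : CartierDivisor X.X.left) (R Q : X.Points K) :
    ((X.weilDiv Θ R).pullback (X.translation Q).left).LinEquiv (X.weilDiv Θ R) := by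
  have h1 := X.pullback_translation_weilDiv_add_linEquiv Θ Q R
  have h2 := X.weilDiv_mul_linEquiv Θ R Q
  rw [← CartierDivisor.cechClass_eq_iff_linEquiv] at h1 h2 ⊢
  rw [CartierDivisor.cechClass_add] at h1 h2
  exact mul_right_cancel (h1.trans h2)

/-- **`t_P ≫ (−1) = (−1) ≫ t_{P⁻¹}`** on the underlying scheme of an abelian variety (`(−1)` is a homomorphism sending `P`
to `P⁻¹`: ★ `translation_comp_hom_eq` for `[-1]`, ★ `zsmulPt_neg_one_eq_inv`, ★ `comp_zsmulPt_neg_one`). [cite: MumfordAV1970, §4 (Cor. 1 of the rigidity lemma) and §8 (pp. 74–75)] -/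
theorem translation_left_comp_inv (P : X.Points K) :
    (X.translation P).left ≫ ((𝟙 X.X)⁻¹ : X.X ⟶ X.X).left =
      ((𝟙 X.X)⁻¹ : X.X ⟶ X.X).left ≫ (X.translation P⁻¹).left := by
  have h := AbelianVariety.translation_comp_hom_eq ((-1 : ℤ) • 𝟙 X) P
  have hmap : AlgPoints.map ((-1 : ℤ) • 𝟙 X).hom.hom.hom P = P⁻¹ := X.comp_zsmulPt_neg_one P
  rw [hmap] at h
  rw [← X.zsmulPt_neg_one_eq_inv]
  exact congrArg CommaMorphism.left h

end Fibre

variable {S : Scheme.{u}} (A : AbelianSchemeOver S) (D : A.DualPair) (lam : A.X ⟶ D.hat.X) {Ω : Type u} [Field Ω]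
  (s : Spec (.of Ω) ⟶ S)

/-- **A divisor with the same `D_P`-classes is again a witness**: if `λ̄ = Λ(𝒪(Θ))` at `s` and `D_P(Θ′) ∼ D_P(Θ)` for every
`P ∈ A_s(Ω)`, then `λ̄ = Λ(𝒪(Θ′))` at `s` (★ (D-2) dictionary `weilDiv_linEquiv_iff_nonempty_translateTensorDual_iso`).
[cite: MumfordFogartyKirwan1994, Ch. 6 §2 Definition 6.2–6.3 (p. 120)] -/
theorem IsLambdaOfAt.of_forall_weilDiv_linEquiv {Θ Θ' : CartierDivisor (A.fibre s).toAbelianVariety.X.left}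
    (h : A.IsLambdaOfAt s D lam Θ)
    (hlin : ∀ P : (A.fibre s).toAbelianVariety.Points Ω,
      ((A.fibre s).toAbelianVariety.weilDiv Θ' P).LinEquiv ((A.fibre s).toAbelianVariety.weilDiv Θ P)) :
    A.IsLambdaOfAt s D lam Θ' := by
  intro P
  obtain ⟨i⟩ := h P
  obtain ⟨j⟩ := (weilDiv_linEquiv_iff_nonempty_translateTensorDual_iso (A.fibre s).toAbelianVariety Θ Θ' P P).1 (hlin P)
  exact ⟨i ≪≫ j.symm⟩

/-- The class of `D_Q(Θ)`: `[D_Q(Θ)] = t_Q^*[Θ] · [Θ]⁻¹` in `Ȟ¹(A_s, 𝒪^×)`. [cite: MumfordAV1970, §8 (pp. 74–75)] -/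
theorem cechClass_weilDiv {K : Type u} [Field K] (X : AbelianVariety K) (Θ : CartierDivisor X.X.left) (Q : X.Points K) :
    (X.weilDiv Θ Q).cechClass = CechPic.pullback (X.translation Q).left Θ.cechClass * Θ.cechClass⁻¹ := by
  simp only [AbelianVariety.weilDiv, CartierDivisor.cechClass_add, CartierDivisor.cechClass_pullback, cechClass_neg_eq_inv']

/-! ## §2 `(−1)^*` of a witness, and translates of a witness, are witnesses -/

/-- **`Λ(𝒪((−1)^*Θ)) = Λ(𝒪(Θ))`: the pull-back of a witness along the inversion is a witness of the SAME `λ̄`** —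
`D_P((−1)^*Θ) = (−1)^*D_{P⁻¹}(Θ)` (`t_P ≫ (−1) = (−1) ≫ t_{P⁻¹}`), `(−1)^*D_{P⁻¹}(Θ) ∼ −D_{P⁻¹}(Θ)` ([MumfordAV1970] §8 (iii)
for the translation-invariant `D_{P⁻¹}(Θ)`, ★ `cechClass_classPullback_inv_eq_inv`), and `−D_{P⁻¹}(Θ) ∼ D_P(Θ)` (square).
[cite: MumfordAV1970, §8 (ii)–(iv) (pp. 74–75)] [cite: MumfordFogartyKirwan1994, Ch. 6 §2 Definition 6.2–6.3 (p. 120)] -/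
theorem IsLambdaOfAt.classPullback_inv [IsAlgClosed Ω] {Θ : CartierDivisor (A.fibre s).toAbelianVariety.X.left}
    (h : A.IsLambdaOfAt s D lam Θ) :
    A.IsLambdaOfAt s D lam (Θ.classPullback (((𝟙 (A.fibre s).toAbelianVariety.X)⁻¹ :
      (A.fibre s).toAbelianVariety.X ⟶ (A.fibre s).toAbelianVariety.X)).left) := by
  haveI : IsIso ((((𝟙 (A.fibre s).toAbelianVariety.X)⁻¹ :
      (A.fibre s).toAbelianVariety.X ⟶ (A.fibre s).toAbelianVariety.X)).left) := by
    rw [← (A.fibre s).toAbelianVariety.zsmulPt_neg_one_eq_inv]; infer_instance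
  refine IsLambdaOfAt.of_forall_weilDiv_linEquiv A D lam s h fun P => ?_
  rw [← CartierDivisor.cechClass_eq_iff_linEquiv, cechClass_weilDiv, cechClass_weilDiv,
    CartierDivisor.cechClass_classPullback, ← CechPic.pullback_comp, translation_left_comp_inv,
    CechPic.pullback_comp, ← map_inv, ← map_mul, ← cechClass_weilDiv, ← CartierDivisor.cechClass_classPullback,
    cechClass_classPullback_inv_eq_inv (A.fibre s).toAbelianVariety _
      (fun Q => weilDiv_translationInvariant (A.fibre s).toAbelianVariety Θ P⁻¹ Q)]
  -- `[D_{P⁻¹}]⁻¹ = [D_P]`: `[D_1] = [D_P][D_{P⁻¹}]`, `[D_1] = 1`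
  have hmul := (A.fibre s).toAbelianVariety.weilDiv_mul_linEquiv Θ P P⁻¹
  rw [mul_inv_cancel] at hmul
  have h1 := ((A.fibre s).toAbelianVariety.weilDiv_one_linEquiv_zero Θ).symm.trans hmul
  rw [← CartierDivisor.cechClass_eq_iff_linEquiv, CartierDivisor.cechClass_zero, CartierDivisor.cechClass_add] at h1
  rw [← cechClass_weilDiv]
  exact (eq_inv_of_mul_eq_one_left h1.symm).symm

/-- **A translate `t_y^*Θ` of a witness is a witness of the SAME `λ̄`**: `D_P(t_y^*Θ) = t_P^*t_y^*Θ − t_y^*Θ`,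
`t_P ≫ t_y = t_{Py}`, so `[D_P(t_y^*Θ)] = [D_{Py}]·[D_y]⁻¹ = [D_P]` (theorem of the square).
[cite: MumfordAV1970, §6 Cor. 4 (p. 59)] [cite: MumfordFogartyKirwan1994, Ch. 6 §2 Definition 6.2–6.3 (p. 120)] -/
theorem IsLambdaOfAt.pullback_translation {Θ : CartierDivisor (A.fibre s).toAbelianVariety.X.left}
    (h : A.IsLambdaOfAt s D lam Θ) (y : (A.fibre s).toAbelianVariety.Points Ω) :
    A.IsLambdaOfAt s D lam (Θ.pullback ((A.fibre s).toAbelianVariety.translation y).left) := by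
  refine IsLambdaOfAt.of_forall_weilDiv_linEquiv A D lam s h fun P => ?_
  have hcomp : ((A.fibre s).toAbelianVariety.translation P).left ≫ ((A.fibre s).toAbelianVariety.translation y).left =
      ((A.fibre s).toAbelianVariety.translation (P * y)).left := by
    rw [← Over.comp_left, AbelianVariety.translation_comp']
  have hmul := (A.fibre s).toAbelianVariety.weilDiv_mul_linEquiv Θ P y
  rw [← CartierDivisor.cechClass_eq_iff_linEquiv, CartierDivisor.cechClass_add, cechClass_weilDiv, cechClass_weilDiv,
    cechClass_weilDiv] at hmul
  rw [← CartierDivisor.cechClass_eq_iff_linEquiv, cechClass_weilDiv, cechClass_weilDiv, CartierDivisor.cechClass_pullback,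
    ← CechPic.pullback_comp, hcomp]
  -- `hmul : t_{Py}^*c · c⁻¹ = (t_P^*c · c⁻¹) · (t_y^*c · c⁻¹)`
  rw [mul_inv_eq_iff_eq_mul] at hmul ⊢
  rw [hmul]
  group

/-! ## §3 The symmetric translate -/

/-- **A SYMMETRIC ample witness from ONE solvability**: let `λ̄ = Λ(𝒪(Θ))` at `s` with `Θ` ample, `2` invertible in `Ω`,
and suppose the (translation-invariant) class `Z := (−1)^*Θ − Θ` is `∼ D_a(Θ)` for some `a ∈ A_s(Ω)` (`hZ`: Mumford §8
Thm. 1 at `s`).  Then for `y` with `y² = a` (★ `exists_pow_eq_of_isAlgClosed`) the translate `Θ′ := t_y^*Θ` is ample (★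
`IsAmple.pullback`), a witness of `λ̄` (§2), and SYMMETRIC: `(−1)^*t_y^*Θ = t_{y⁻¹}^*(−1)^*Θ ∼ t_{y⁻¹}^*t_a^*Θ = t_{a y⁻¹}^*Θ = t_y^*Θ`
in `Ȟ¹`. [cite: MumfordAV1970, §8 (ii)–(iv) (pp. 74–75) and §8 Thm. 1 (p. 77)] [cite: MumfordFogartyKirwan1994, Ch. 6 §2 Definition 6.2–6.3 (p. 120)] -/
theorem IsLambdaOfAt.exists_symmetric_translate [IsAlgClosed Ω] {Θ : CartierDivisor (A.fibre s).toAbelianVariety.X.left}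
    (h : A.IsLambdaOfAt s D lam Θ) (hΘ : Θ.IsAmple) (h2 : (2 : Ω) ≠ 0)
    (hZ : ∃ a : (A.fibre s).toAbelianVariety.Points Ω,
      (Θ.classPullback (((𝟙 (A.fibre s).toAbelianVariety.X)⁻¹ :
          (A.fibre s).toAbelianVariety.X ⟶ (A.fibre s).toAbelianVariety.X)).left + -Θ).LinEquiv
        ((A.fibre s).toAbelianVariety.weilDiv Θ a)) :
    ∃ Θ' : CartierDivisor (A.fibre s).toAbelianVariety.X.left, Θ'.IsAmple ∧ A.IsLambdaOfAt s D lam Θ' ∧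
      (Θ'.classPullback (((𝟙 (A.fibre s).toAbelianVariety.X)⁻¹ :
        (A.fibre s).toAbelianVariety.X ⟶ (A.fibre s).toAbelianVariety.X)).left).LinEquiv Θ' := by
  haveI : IsIso ((((𝟙 (A.fibre s).toAbelianVariety.X)⁻¹ :
      (A.fibre s).toAbelianVariety.X ⟶ (A.fibre s).toAbelianVariety.X)).left) := by
    rw [← (A.fibre s).toAbelianVariety.zsmulPt_neg_one_eq_inv]; infer_instance
  obtain ⟨a, ha⟩ := hZ
  obtain ⟨y, hy⟩ := (A.fibre s).toAbelianVariety.exists_pow_eq_of_isAlgClosed 2 (by exact_mod_cast h2) a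
  refine ⟨Θ.pullback ((A.fibre s).toAbelianVariety.translation y).left, hΘ.pullback _,
    IsLambdaOfAt.pullback_translation A D lam s h y, ?_⟩
  -- `(−1)^*[Θ] = t_a^*[Θ]` from `hZ`
  have hinv : CechPic.pullback ((((𝟙 (A.fibre s).toAbelianVariety.X)⁻¹ :
        (A.fibre s).toAbelianVariety.X ⟶ (A.fibre s).toAbelianVariety.X)).left) Θ.cechClass =
      CechPic.pullback ((A.fibre s).toAbelianVariety.translation a).left Θ.cechClass := by
    rw [← CartierDivisor.cechClass_eq_iff_linEquiv, CartierDivisor.cechClass_add, CartierDivisor.cechClass_classPullback,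
      cechClass_neg_eq_inv', cechClass_weilDiv] at ha
    exact mul_right_cancel ha
  -- `t_{y⁻¹} ≫ (−1) = (−1) ≫ t_y` and `t_{y⁻¹} ≫ t_a = t_{a y⁻¹} = t_y`
  have hcomm := translation_left_comp_inv (A.fibre s).toAbelianVariety y⁻¹
  rw [inv_inv] at hcomm
  have hay : a * y⁻¹ = y := by rw [← hy, pow_two, mul_inv_cancel_right]
  have hcomp : ((A.fibre s).toAbelianVariety.translation y⁻¹).left ≫ ((A.fibre s).toAbelianVariety.translation a).left =
      ((A.fibre s).toAbelianVariety.translation y).left := by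
    rw [← Over.comp_left, AbelianVariety.translation_comp, hay]
  rw [← CartierDivisor.cechClass_eq_iff_linEquiv, CartierDivisor.cechClass_classPullback, CartierDivisor.cechClass_pullback,
    ← CechPic.pullback_comp, ← hcomm, CechPic.pullback_comp, hinv, ← CechPic.pullback_comp, hcomp]

/-! ## §4 The symmetric ample witness exists: at complex points unconditionally; in general from Mumford §8 Thm. 1 at the point -/

namespace Polarization

/-- **SYMMETRIC AMPLE WITNESSES AT AN ALGEBRAICALLY CLOSED POINT, from Mumford §8 Thm. 1 at that point**: for a polarisation
`λ` with witness `Θ` at `s` (`Ω` algebraically closed, `2` invertible) such that every translation-invariant divisor class on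
`A_s` is a `D_a(Θ)` (`hF2`), there is an ample SYMMETRIC witness `Θ′` of `λ̄` at `s` — `Z := (−1)^*Θ − Θ` is translation
invariant by ★ `IsLambdaOfAt.linEquiv_pullback_translation_sub` (both `Θ` and `(−1)^*Θ` are witnesses, §2), so §3 applies.
[cite: MumfordAV1970, §8 Thm. 1 (p. 77) and §8 (ii)–(iv) (pp. 74–75)] [cite: MumfordFogartyKirwan1994, Ch. 6 §2 Definition 6.2–6.3 (p. 120)] -/
theorem exists_isAmple_isLambdaOfAt_symmetric_of_forall_exists_linEquiv_weilDiv [IsAlgClosed Ω] {D : A.DualPair}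
    (pol : A.Polarization D) (h2 : (2 : Ω) ≠ 0) {Θ : CartierDivisor (A.fibre s).toAbelianVariety.X.left} (hΘ : Θ.IsAmple)
    (h : A.IsLambdaOfAt s D pol.lam Θ)
    (hF2 : ∀ Z : CartierDivisor (A.fibre s).toAbelianVariety.X.left,
      (∀ P : (A.fibre s).toAbelianVariety.Points Ω,
        (Z.pullback ((A.fibre s).toAbelianVariety.translation P).left).LinEquiv Z) →
      ∃ a : (A.fibre s).toAbelianVariety.Points Ω, Z.LinEquiv ((A.fibre s).toAbelianVariety.weilDiv Θ a)) :
    ∃ Θ' : CartierDivisor (A.fibre s).toAbelianVariety.X.left, Θ'.IsAmple ∧ A.IsLambdaOfAt s D pol.lam Θ' ∧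
      (Θ'.classPullback (((𝟙 (A.fibre s).toAbelianVariety.X)⁻¹ :
        (A.fibre s).toAbelianVariety.X ⟶ (A.fibre s).toAbelianVariety.X)).left).LinEquiv Θ' := by
  have hW := IsLambdaOfAt.classPullback_inv A D pol.lam s h
  exact IsLambdaOfAt.exists_symmetric_translate A D pol.lam s h hΘ h2
    (hF2 _ fun P => IsLambdaOfAt.linEquiv_pullback_translation_sub hW h P)

end Polarization

end AbelianSchemeOver

/-! ### Complex points -/

namespace AbelianSchemeOver.Polarization

variable {S : Scheme.{0}} {A : AbelianSchemeOver S} {D : A.DualPair} (pol : A.Polarization D)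

/-- **AT EVERY COMPLEX POINT A POLARISATION HAS A SYMMETRIC AMPLE WITNESS — unconditionally**: for `t : Spec ℂ → S` there is
an ample Cartier divisor `Θ′` on `A_t` with `λ̄ = Λ(𝒪(Θ′))` at `t` and `(−1)^*Θ′ ∼ Θ′`.  The ample witness `Θ` of ★
`Polarization.exists_ample` is corrected by a translate: `(−1)^*Θ − Θ` is translation-invariant (§2 + ★ witness congruence),
hence `∼ D_a(Θ)` by **Mumford §8 Theorem 1 over `ℂ`** (★ `exists_linEquiv_weilDiv_of_forall_translate_linEquiv`), and §3.
[cite: MumfordAV1970, §8 Thm. 1 (p. 77) and §8 (ii)–(iv) (pp. 74–75)] [cite: MumfordFogartyKirwan1994, Ch. 6 §2 Definition 6.2–6.3 (p. 120)] -/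
theorem exists_isAmple_isLambdaOfAt_symmetric_of_complexPoint (t : Spec (.of ℂ) ⟶ S) :
    ∃ Θ' : CartierDivisor (A.fibre t).toAbelianVariety.X.left, Θ'.IsAmple ∧ A.IsLambdaOfAt t D pol.lam Θ' ∧
      (Θ'.classPullback (((𝟙 (A.fibre t).toAbelianVariety.X)⁻¹ :
        (A.fibre t).toAbelianVariety.X ⟶ (A.fibre t).toAbelianVariety.X)).left).LinEquiv Θ' := by
  obtain ⟨Θ, hΘ, h⟩ := pol.exists_ample ℂ t
  exact pol.exists_isAmple_isLambdaOfAt_symmetric_of_forall_exists_linEquiv_weilDiv A t two_ne_zero hΘ h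
    fun Z hZ => (A.fibre t).toAbelianVariety.exists_linEquiv_weilDiv_of_forall_translate_linEquiv hΘ Z hZ

end AbelianSchemeOver.Polarization

end Literature.AlgebraicGeometry.AbelianSchemes

end
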